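import Summits.Ventures.Crystal3D.Theorems.StickyWulffConstantTextureBuildHealedComposition
import HarnessLib

/-!
# TB-1: the healed binder WITH OVERLAP — the cover's healed configuration keeps all but `δN` of the cluster's balls
# (lane T, crux `TextureLiminfV5`, stmt-Ventures-23912; option for the v8.24 re-typing of `stub_TB_cover`, census memo TB-COVER-CENSUS-g23.md §F2)

HONEST FRAMING. Venture `Summits/Ventures/Crystal3D` (cell `crystal3d-full`), route `route-Ventures-StickyWulffConstant`, helper `--supports` the
law-v5 crux `TextureLiminfV5` (stmt-Ventures-23912).  Pure logic over '…TextureBuildHealedComposition' (census-free, standard axioms).  No cover is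
built; F-C1 not moved.

WHY.  `CoverH` (p744930) lets the cover replace the cluster `x` by ANY packing `x'` with no larger deficiency and enough balls — honest for the
composition, but it does not pin the METHOD (a wholesale replacement of `x` by a smaller perfect crystal would also have the right shape, at the price of
the summit inequality itself).  The intended constructor HEALS only sparse bounded junk, so it meets the TIGHT form below, which additionally demands that
the healed configuration KEEP at least `(1 − δ)N` of the original balls.  The planner may register either; the composition is the same.

* `CoverHT Adh` — `CoverH` + the overlap clause `(1 − δ)N ≤ #{i | x i ∈ range x'}`;
* `coverH_of_coverHT` — tight ⇒ healed (drop the clause); `coverHT_of_cover` — the registered v8.23 shape ⇒ tight (`x' := x`);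
* `shadowTheoremSatAtomicV5_of_healedT₇_slack` / `textureBuildHT₇_of_stubs` — the composition over the tight binder.
-/

noncomputable section

open scoped BigOperators InnerProductSpace
open MeasureTheory

namespace Summit.Ventures.Crystal3D.Cruxes.TextureLiminf.TexShadow

open Summit.Ventures.Crystal3D Summit.Ventures.Crystal3D.Theorems

open scoped Classical in
/-- **THE TIGHT HEALED BINDER SHAPE of `stub_TB_cover`**: as `CoverH`, and the healed packing keeps at least `(1 − δ)N` of the cluster's balls. -/
def CoverHT (Adh : Prop) : Prop :=
  BarlowResolution → Adh →
    ∀ C R₀ : ℝ, 1 ≤ R₀ → ∀ K δ θ : ℝ, 0 < δ → 0 < θ → ∃ N₀ : ℕ, ∀ N : ℕ, N₀ ≤ N → ∀ x : Fin N → E3, IsUnitPacking x →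
      IsSaturated x → 6 * (N : ℝ) - (numContacts x : ℝ) ≤ K * (N : ℝ) ^ ((2 : ℝ) / 3) →
      ∃ (N' : ℕ) (x' : Fin N' → E3) (δ' : ℝ), (1 - δ) * (N : ℝ) ≤ (1 - δ') * (N' : ℝ) ∧
        6 * (N' : ℝ) - (numContacts x' : ℝ) ≤ 6 * (N : ℝ) - (numContacts x : ℝ) ∧
        (1 - δ) * (N : ℝ) ≤ ((Finset.univ.filter fun i : Fin N => x i ∈ Set.range x').card : ℝ) ∧
        ∃ (rc : RiseredCover C R₀ N' x') (μ : Mesh₇ rc δ'),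
          rc.tilingLoss₂ + rc.rimSum + μ.gapCost ≤ θ * (N : ℝ) ^ ((2 : ℝ) / 3) + rc.unownedSlack₃

/-- Tight ⇒ healed (drop the overlap clause). -/
theorem coverH_of_coverHT {Adh : Prop} (h : CoverHT Adh) : CoverH Adh := by
  intro hres hadh C R₀ hR₀ K δ θ hδ hθ
  obtain ⟨N₀, hN₀⟩ := h hres hadh C R₀ hR₀ K δ θ hδ hθ
  refine ⟨N₀, fun N hN x hx hsat hK => ?_⟩
  obtain ⟨N', x', δ', h1, h2, -, rc, μ, h4⟩ := hN₀ N hN x hx hsat hK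
  exact ⟨N', x', δ', h1, h2, rc, μ, h4⟩

open scoped Classical in
/-- **The registered (v8.23) binder shape implies the tight healed one** (`N' := N`, `x' := x`, `δ' := δ`; every ball is kept). -/
theorem coverHT_of_cover {Adh : Prop}
    (hcover : BarlowResolution → Adh →
      ∀ C R₀ : ℝ, 1 ≤ R₀ → ∀ K δ θ : ℝ, 0 < δ → 0 < θ → ∃ N₀ : ℕ, ∀ N : ℕ, N₀ ≤ N → ∀ x : Fin N → E3, IsUnitPacking x →
        IsSaturated x → 6 * (N : ℝ) - (numContacts x : ℝ) ≤ K * (N : ℝ) ^ ((2 : ℝ) / 3) →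
        ∃ (rc : RiseredCover C R₀ N x) (μ : Mesh₇ rc δ),
          rc.tilingLoss₂ + rc.rimSum + μ.gapCost ≤ θ * (N : ℝ) ^ ((2 : ℝ) / 3) + rc.unownedSlack₃) :
    CoverHT Adh := by
  intro hres hadh C R₀ hR₀ K δ θ hδ hθ
  obtain ⟨N₀, hN₀⟩ := hcover hres hadh C R₀ hR₀ K δ θ hδ hθ
  refine ⟨N₀, fun N hN x hx hsat hK => ?_⟩
  obtain ⟨rc, μ, h⟩ := hN₀ N hN x hx hsat hK
  refine ⟨N, x, δ, le_rfl, le_rfl, ?_, rc, μ, h⟩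
  have hall : (Finset.univ.filter fun i : Fin N => x i ∈ Set.range x) = Finset.univ :=
    Finset.filter_true_of_mem fun i _ => ⟨i, rfl⟩
  rw [hall, Finset.card_univ, Fintype.card_fin]
  have hN0 : (0 : ℝ) ≤ N := Nat.cast_nonneg N
  nlinarith

/-- **THE LEVEL-2 COMPOSITION over the tight healed binder.** -/
theorem shadowTheoremSatAtomicV5_of_healedT₇_slack {Adh : Prop} (hcover : CoverHT Adh)
    (henergy : PolytopeCalculus → BarlowFreeCertificate →
      ∀ (C R₀ : ℝ), 1 ≤ R₀ → ∀ (N : ℕ) (x : Fin N → E3) (δ : ℝ) (rc : RiseredCover C R₀ N x) (μ : Mesh₇ rc δ),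
        ∃ (n : ℕ) (G : Fin n → Set E3) (A : Fin n → (E3 ≃ₗᵢ[ℝ] E3)) (c : Fin n → Fin n → ℝ) (m : Fin n → Fin n → E3),
          IsTexture (13 / 25) (1 / 2) n G A c m ∧ (1 - δ) * (N : ℝ) ≤ Real.sqrt 2 * vol n G ∧
          energy n G A c m ≤ rc.tentBudget + rc.chargeSum + rc.riserSum + μ.gapCost) :
    BarlowResolution → Adh → BilayerWallV5 → PolytopeCalculus → BarlowFreeCertificate → ShadowTheoremSatAtomicV5 :=
  shadowTheoremSatAtomicV5_of_healed₇_slack (coverH_of_coverHT hcover) henergy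

/-- **THE COMPOSITION OF RECORD over the tight healed binder**: ⇒ the registered shape of `stub_textureBuild`. -/
theorem textureBuildHT₇_of_stubs {Adh : Prop} (hcover : CoverHT Adh)
    (henergy : PolytopeCalculus → BarlowFreeCertificate →
      ∀ (C R₀ : ℝ), 1 ≤ R₀ → ∀ (N : ℕ) (x : Fin N → E3) (δ : ℝ) (rc : RiseredCover C R₀ N x) (μ : Mesh₇ rc δ),
        ∃ (n : ℕ) (G : Fin n → Set E3) (A : Fin n → (E3 ≃ₗᵢ[ℝ] E3)) (c : Fin n → Fin n → ℝ) (m : Fin n → Fin n → E3),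
          IsTexture (13 / 25) (1 / 2) n G A c m ∧ (1 - δ) * (N : ℝ) ≤ Real.sqrt 2 * vol n G ∧
          energy n G A c m ≤ rc.tentBudget + rc.chargeSum + rc.riserSum + μ.gapCost) :
    BarlowResolution → Adh → BilayerWallV5 → PolytopeCalculus → BarlowFreeCertificate → ShadowTheoremSatV5 :=
  textureBuildH₇_of_stubs (coverH_of_coverHT hcover) henergy

end Summit.Ventures.Crystal3D.Cruxes.TextureLiminf.TexShadow

end
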